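import Summits.QuantumFields.BalabanUV.T4Continuum.Spine.NE3.FrameNormalisationOneLevel
import Summits.QuantumFields.BalabanUV.T4Continuum.Support.AveragingDeficitTransport
import Literature.MathematicalPhysics.QuantumFieldTheory.Balaban1983to89.B7Prop10InLambda
import HarnessLib

/-!
# T⁴ programme, node NE3 — census R50 open half (M1), NINTH BRICK: the covariant block oscillation along the TREE contours needs the covariant gradient on POSITIVE (tree)
# bonds only — `η ≤ d·L·G₊`, the form that matches the block-axial gauge of the background (`FrameNormalisationOscillationTree`)

Cell `pub-balaban-gaps` (track G2, seat ne3, generation 11), row NE3; census `HOME/ne/NE3.md` §4 R50, §17 (M1).  `FrameNormalisationOscillation.norm_covOsc_sub_one_le` bounds the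
covariant block oscillation `δ_v(y,Γ)` by `|Γ|·G` with `G` a bound on the covariant bond gradient over ALL letters (both orientations).  LOCATED (census §17 (M1) recipe (i)): for a
CURVED background `W` the covariant gradient `v(x)⁻¹R(W(x,μ))v(x+e_μ)` differs from the plain difference of a smooth interpolant by a commutator `[W(x,μ), v]` of (0)-size, so the
smooth realisation works in the BLOCK-AXIAL gauge of `W`, where the background is `1` exactly on the TREE bonds — the positively oriented bonds of the contours `Γ_{y,y+r}`
(`B7Prop10InLambda.treeWord_boxVec_pos`).  Hence the form of brick 3 that the contraction uses: the hypothesis on the POSITIVE letters only.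

* `covOsc_cons_pos` — the one-letter recursion for a positive letter: `δ_v(y,(μ,+)::Γ) = [v(y)⁻¹R(V₀(y,μ))v(y+e_μ)] · R(V₀(y,μ)) δ_v(y+e_μ,Γ)`.
* **`norm_covOsc_sub_one_le_pos`** — unitary `V₀`, `v` with `‖v(x)⁻¹R(V₀(x,μ))v(x+e_μ) − 1‖ ≤ G` for every site and direction: for every word of POSITIVE letters,
  `‖δ_v(y,Γ) − 1‖ ≤ |Γ|·G`.
* **`norm_covOsc_treeWord_sub_one_le_pos`** ∕ `…_inv_…` — on the block tree contours: `‖δ_v(y,Γ_{y,y+r})^{±1} − 1‖ ≤ d·L·G`.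

HONEST FRAMING (page 1).  Bookkeeping on OUR objects (0 def, 0 sorry); the block-axial transport of the whole construction and the contraction are NOT done; nothing of Bałaban's
asserted; **NE3 NOT proved**; `PairLandauGaugeB8Avg` and the covariant root NOT proved; spine PROVED 0∕9; finite T⁴ rung (B)+1 — NOT continuum YM on ℝ⁴, NOT infinite volume, NOT
mass gap, NOT `BetaPertH`, NOT Clay.  HONEST DEPENDENCY: continuum YM on T⁴ ⇐ BetaPertH ∧ nine spine estimates (0/9 proved); BetaPertH ⇐ (D1) ∧ (D4) ∧ CAP+tail; G-an2-4 gates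
asym, D1 and NE2/3/4.  PLACEMENT: `Summits/QuantumFields/BalabanUV/T4Continuum/Spine/NE3/`; imports `FrameNormalisationOneLevel`, `Support/AveragingDeficitTransport`, `B7Prop10InLambda`.

References: [Balaban1985Averaging] T. Bałaban, *Averaging operations for lattice gauge theories*, CMP 98 (1985) 17–51: (9) p. 18, p. 24 (tree contours), (56)–(60) p. 27, (78) p. 30;
[Balaban1985RegularSpaces] CMP 99 (1985), (1.15)–(1.16) p. 78 (axial gauge).
-/

set_option autoImplicit false

open scoped BigOperators Matrix Matrix.Norms.L2Operator
open NormedSpace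

namespace Summit.QuantumFields.BalabanUV.T4Continuum.NE3.FrameNormalisationOscillationTree

open Literature.MathematicalPhysics.QuantumFieldTheory.Balaban1983to89
open B7Prop1Explicit B7Prop2Explicit
open B7Eq92Concrete (Rc Rc_apply)
open T4AveragingDeficitWall (Ad)
open AveragingDeficitTransport (norm_Ad_of_unitary)
open B7Prop10InLambda (treeWord_boxVec_pos)

noncomputable section

variable {d : ℕ} {n : Type*} [Fintype n] [DecidableEq n]

/-- **One positive letter**: `δ_v(y,(μ,+)::Γ) = [v(y)⁻¹·R(V₀(y,μ))v(y+e_μ)] · R(V₀(y,μ)) δ_v(y+e_μ,Γ)` (group algebra). [folklore] -/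
theorem covOsc_cons_pos (V₀ : Site d → Fin d → (Matrix n n ℂ)ˣ) (v : Site d → (Matrix n n ℂ)ˣ) (y : Site d) (μ : Fin d) (w : List (Letter d)) :
    (v y)⁻¹ * Rc (hol V₀ y (((μ, true) : Letter d) :: w)) (v (y + disp (((μ, true) : Letter d) :: w)))
      = ((v y)⁻¹ * Rc (V₀ y μ) (v (y + e μ))) *
          Rc (V₀ y μ) ((v (y + e μ))⁻¹ * Rc (hol V₀ (y + e μ) w) (v (y + e μ + disp w))) := by
  rw [hol_cons, disp_cons, stepHol_true, Letter.vec_true, ← add_assoc]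
  simp only [Rc_apply, map_mul, map_inv, mul_inv_rev]
  group

/-- **`‖δ_v(y,Γ) − 1‖ ≤ |Γ|·G` ALONG WORDS OF POSITIVE LETTERS**, for unitary `V₀`, `v` whose covariant gradients on the positively oriented bonds satisfy
`‖v(x)⁻¹·R(V₀(x,μ))v(x+e_μ) − 1‖ ≤ G`. [folklore] -/
theorem norm_covOsc_sub_one_le_pos [Nonempty n] {V₀ : Site d → Fin d → (Matrix n n ℂ)ˣ} {v : Site d → (Matrix n n ℂ)ˣ} {G : ℝ}
    (hV₀ : ∀ (x : Site d) (κ : Fin d), V₀ x κ ∈ unitaryUnits (Matrix n n ℂ)) (hv : ∀ x : Site d, v x ∈ unitaryUnits (Matrix n n ℂ))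
    (hg : ∀ (x : Site d) (μ : Fin d), ‖((((v x)⁻¹ * Rc (V₀ x μ) (v (x + e μ))) : (Matrix n n ℂ)ˣ) : Matrix n n ℂ) - 1‖ ≤ G) :
    ∀ (w : List (Letter d)), (∀ l ∈ w, l.2 = true) → ∀ y : Site d,
      ‖((((v y)⁻¹ * Rc (hol V₀ y w) (v (y + disp w))) : (Matrix n n ℂ)ˣ) : Matrix n n ℂ) - 1‖ ≤ (w.length : ℝ) * G := by
  letI : CStarAlgebra (Matrix n n ℂ) := {}
  have hRc : ∀ {h : (Matrix n n ℂ)ˣ} (_ : h ∈ unitaryUnits (Matrix n n ℂ)) (X : (Matrix n n ℂ)ˣ),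
      ‖((Rc h X : (Matrix n n ℂ)ˣ) : Matrix n n ℂ) - 1‖ = ‖(X : Matrix n n ℂ) - 1‖ := by
    intro h hh X
    have hAd : ((Rc h X : (Matrix n n ℂ)ˣ) : Matrix n n ℂ) - 1 = Ad h ((X : Matrix n n ℂ) - 1) := by
      unfold Ad
      rw [Rc_apply, Units.val_mul, Units.val_mul, mul_sub, sub_mul, mul_one, Units.mul_inv]
    rw [hAd, norm_Ad_of_unitary hh]
  have hgu : ∀ (x : Site d) (μ : Fin d), (v x)⁻¹ * Rc (V₀ x μ) (v (x + e μ)) ∈ unitaryUnits (Matrix n n ℂ) := by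
    intro x μ
    rw [Rc_apply]
    exact (unitaryUnits _).mul_mem ((unitaryUnits _).inv_mem (hv x))
      ((unitaryUnits _).mul_mem ((unitaryUnits _).mul_mem (hV₀ x μ) (hv _)) ((unitaryUnits _).inv_mem (hV₀ x μ)))
  intro w
  induction w with
  | nil =>
    intro _ y
    simp [disp, Rc_apply]
  | cons l w ih =>
    intro hw y
    obtain ⟨μ, b⟩ := l
    have hb : b = true := hw (μ, b) List.mem_cons_self
    subst hb
    have hw' : ∀ l' ∈ w, l'.2 = true := fun l' hl' => hw l' (List.mem_cons_of_mem _ hl')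
    rw [covOsc_cons_pos, List.length_cons, Nat.cast_succ, add_mul, one_mul, add_comm ((w.length : ℝ) * G)]
    refine (B8Lemma1NonAbelian.norm_units_mul_sub_one_le (unitaryUnits_le_U1 (hgu y μ))).trans (add_le_add (hg y μ) ?_)
    rw [hRc (hV₀ y μ)]
    exact ih hw' (y + e μ)

/-- **On the block tree contours** (`Γ_{y,y+r}` is a word of positive letters, `|Γ_{y,y+r}| ≤ d·L`): `‖δ_v(y,Γ_{y,y+r}) − 1‖ ≤ d·L·G`. [folklore] -/
theorem norm_covOsc_treeWord_sub_one_le_pos [Nonempty n] (L : ℕ) {V₀ : Site d → Fin d → (Matrix n n ℂ)ˣ} {v : Site d → (Matrix n n ℂ)ˣ} {G : ℝ} (hG : 0 ≤ G)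
    (hV₀ : ∀ (x : Site d) (κ : Fin d), V₀ x κ ∈ unitaryUnits (Matrix n n ℂ)) (hv : ∀ x : Site d, v x ∈ unitaryUnits (Matrix n n ℂ))
    (hg : ∀ (x : Site d) (μ : Fin d), ‖((((v x)⁻¹ * Rc (V₀ x μ) (v (x + e μ))) : (Matrix n n ℂ)ˣ) : Matrix n n ℂ) - 1‖ ≤ G)
    (y : Site d) (r : Fin d → Fin L) :
    ‖((((v y)⁻¹ * Rc (hol V₀ y (treeWord (boxVec L r))) (v (y + boxVec L r))) : (Matrix n n ℂ)ˣ) : Matrix n n ℂ) - 1‖ ≤ (d : ℝ) * L * G := by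
  have h := norm_covOsc_sub_one_le_pos hV₀ hv hg (treeWord (boxVec L r)) (treeWord_boxVec_pos L r) y
  rw [disp_treeWord, length_treeWord] at h
  refine h.trans (mul_le_mul_of_nonneg_right ?_ hG)
  exact_mod_cast l1_boxVec_le (r := r)

/-- The inverse oscillation on the block tree contours: `‖δ_v(y,Γ_{y,y+r})⁻¹ − 1‖ ≤ d·L·G` (unitarity). [folklore] -/
theorem norm_covOsc_treeWord_inv_sub_one_le_pos [Nonempty n] (L : ℕ) {V₀ : Site d → Fin d → (Matrix n n ℂ)ˣ} {v : Site d → (Matrix n n ℂ)ˣ} {G : ℝ} (hG : 0 ≤ G)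
    (hV₀ : ∀ (x : Site d) (κ : Fin d), V₀ x κ ∈ unitaryUnits (Matrix n n ℂ)) (hv : ∀ x : Site d, v x ∈ unitaryUnits (Matrix n n ℂ))
    (hg : ∀ (x : Site d) (μ : Fin d), ‖((((v x)⁻¹ * Rc (V₀ x μ) (v (x + e μ))) : (Matrix n n ℂ)ˣ) : Matrix n n ℂ) - 1‖ ≤ G)
    (y : Site d) (r : Fin d → Fin L) :
    ‖(((((v y)⁻¹ * Rc (hol V₀ y (treeWord (boxVec L r))) (v (y + boxVec L r)))⁻¹ : (Matrix n n ℂ)ˣ)) : Matrix n n ℂ) - 1‖ ≤ (d : ℝ) * L * G := by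
  letI : CStarAlgebra (Matrix n n ℂ) := {}
  have hu : (v y)⁻¹ * Rc (hol V₀ y (treeWord (boxVec L r))) (v (y + boxVec L r)) ∈ unitaryUnits (Matrix n n ℂ) := by
    rw [Rc_apply]
    have hh := hol_mem_of hV₀ y (treeWord (boxVec L r))
    exact (unitaryUnits _).mul_mem ((unitaryUnits _).inv_mem (hv y))
      ((unitaryUnits _).mul_mem ((unitaryUnits _).mul_mem hh (hv _)) ((unitaryUnits _).inv_mem hh))
  exact (norm_inv_sub_one_le (unitaryUnits_le_U1 hu)).trans (norm_covOsc_treeWord_sub_one_le_pos L hG hV₀ hv hg y r)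

end

end Summit.QuantumFields.BalabanUV.T4Continuum.NE3.FrameNormalisationOscillationTree
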